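import Mathlib
import HarnessLib
import Literature.Combinatorics.Additive.HamidouneRodsethLemmas

/-!
# Hamidoune–Rødseth's inverse theorem mod `p`, III: the components of `A + B` (Lemmas 6 and 7)

Topic `Literature/Combinatorics/Additive`.  Sequel of `HamidouneRodsethRuns.lean`,
`HamidouneRodsethLemmas.lean`; source Y. O. Hamidoune, Ø. J. Rødseth, *An inverse theorem mod p*, Acta
Arith. 92 (2000) 251–262, §4, Lemmas 6 and 7 (pp. 257–259 of the printed paper, read from the publisher's
open copy `paper:url-91a40b2366eb`).

Standing data of both lemmas (p. 257, (9)): `|A + B| = |A| + |B| ≤ p − 4`; `A = A₁ ∪ A₂` and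
`B = B₁ ∪ B₂` are double `d`-progressions given by their two runs (`A₁ = apFinset a₁ d n₁`, …, with
`n₁ + n₂ = |A|`, `m₁ + m₂ = |B|`), `B` has exactly two `d`-components and is NOT an almost `d`-progression.

* the count behind display (11) of the paper: `card_add_apFinset_zero_three_ge`, `card_add_apFinset_zero_mono`,
  and `le_of_apFinset_add_subset_apFinset` ("`|C| ≥ |A₁| + |B| + 1` for a run `C ⊇ A₁ + B`");
* **Lemma 6** (p. 257): `not_add_subset_component` ("`A₁ + B₁` and `A₁ + B₂` lie in distinct components of
  `A + B`", stated as: no component of `A + B` contains `A₁ + B`) and `two_mul_le_card_add_two`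
  (display (10): `|A₁| ≥ |A|/2 − 1`);
* **Lemma 7** (p. 258): `components_of_double_double` — if moreover `A` has exactly two `d`-components and
  is not an almost `d`-progression, and `7 ≤ |A + B|`, then `A + B` has exactly the two
  components `(A₁ + B₁) ∪ (A₂ + B₂)` and `(A₂ + B₁) ∪ (A₁ + B₂)` (with the auxiliary count
  `exists_small_of_three_le_runs` = the printed inequality `|A₁| + |B₂| ≤ 3` when there are three components).

The printed Lemma 7 assumes "`B` is not an almost `d`-progression for any `d`" and derives the same for
`A` through Lemma 5; here both non-almost hypotheses are taken for the one step `d` in play, which is how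
the lemma is used in Lemma 8 / Theorem 3.  Census-silent (pub-omega, seat stpp-1 gen 31).
-/

namespace Literature.Combinatorics.Additive

open Finset
open scoped Pointwise

namespace HamidouneRodseth

variable {p : ℕ} [hp : Fact p.Prime]

/-! ## The count behind display (11) -/

/-- `B + {0, d, 2d}` has at least `|B| + 4` elements when `B` is a double `d`-progression which is not an
almost `d`-progression (and `B + {0,d,2d} ≠ ℤ/pℤ`): `|B + {0,d}| = |B| + 2`, and `B + {0,d}` still has two
components since otherwise observation (IV) would make `B` an almost progression.
[cite: HamidouneRodseth2000, §4 Lemma 6, display (11) (p. 258)] -/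
theorem card_add_apFinset_zero_three_ge {B : Finset (ZMod p)} {d : ZMod p} (hd : d ≠ 0) (hBne : B.Nonempty)
    (hB2 : #((d +ᵥ B) \ B) = 2) (hBna : ∀ b : ZMod p, ¬ B ⊆ apFinset b d (#B + 1))
    (hu : B + apFinset 0 d 3 ≠ univ) : #B + 4 ≤ #(B + apFinset 0 d 3) := by
  rw [← add_pair_add_pair_eq] at hu ⊢
  have h1 := Isoperimetric.card_add_pair_zero_eq B d
  have h2 := Isoperimetric.card_add_pair_zero_eq (B + {0, d}) d
  have hY : B + ({0, d} : Finset (ZMod p)) = B ∪ (d +ᵥ B) := add_pair_zero_eq_union B d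
  have hYu : B ∪ (d +ᵥ B) ≠ univ := by
    rw [← hY]; exact fun h => hu (eq_univ_of_subset (subset_add_left _ (by simp)) h)
  have hge2 : 2 ≤ #((d +ᵥ (B + {0, d})) \ (B + {0, d})) := by
    by_contra hlt
    push Not at hlt
    rw [hY] at hlt
    obtain ⟨s, hs⟩ := subset_apFinset_of_runs_le_two_of_runs_union_le_one hd hBne (by omega) hYu (by omega)
    exact hBna s hs
  omega

/-- Monotone growth along the chain `B + {0, …, J d}`: for `J ≥ 2`,
`|B + {0, d, 2d}| + (J − 2) ≤ |B + {0, …, J d}|` as long as the latter is not `ℤ/pℤ` (each step adds at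
least one point, `Isoperimetric.one_le_card_vadd_sdiff`).
[cite: HamidouneRodseth2000, §4 Lemma 6, display (11) (p. 258)] -/
theorem card_add_apFinset_zero_mono {B : Finset (ZMod p)} {d : ZMod p} (hd : d ≠ 0) (hBne : B.Nonempty) :
    ∀ J : ℕ, 2 ≤ J → B + apFinset 0 d (J + 1) ≠ univ →
      #(B + apFinset 0 d 3) + (J - 2) ≤ #(B + apFinset 0 d (J + 1)) := by
  intro J hJ
  induction J, hJ using Nat.le_induction with
  | base => intro _; simp
  | succ J hJ ih =>
    intro hu
    have hstep : B + apFinset 0 d (J + 1 + 1) = B + apFinset 0 d (J + 1) + {0, d} := by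
      rw [add_assoc B (apFinset 0 d (J + 1)) ({0, d} : Finset (ZMod p)),
        apFinset_add_pair_zero (by omega : 1 ≤ J + 1)]
    have hsub : B + apFinset 0 d (J + 1) ⊆ B + apFinset 0 d (J + 1 + 1) :=
      add_subset_add_left (Isoperimetric.apFinset_mono 0 d (by omega))
    have hu' : B + apFinset 0 d (J + 1) ≠ univ := fun h => hu (eq_univ_of_subset hsub h)
    have hne : (B + apFinset 0 d (J + 1)).Nonempty := hBne.add (apFinset_nonempty 0 d (by omega))
    have h1 := Isoperimetric.one_le_card_vadd_sdiff hne hu' hd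
    have hc := Isoperimetric.card_add_pair_zero_eq (B + apFinset 0 d (J + 1)) d
    rw [← hstep] at hc
    have := ih hu'
    omega

/-- **Display (11) of Hamidoune–Rødseth** (p. 258): "Since `C` is a 1-progression containing `A₁ + B` and
`B` is not an almost-progression, it is then easy to see that `|C| ≥ |A₁| + |B| + 1`."  Here: `A₁` a `d`-run
of `n₁ ≥ 1` terms, `B` a double `d`-progression (two components) which is not an almost `d`-progression,
`A₁ + B ⊆ apFinset c d L ≠ ℤ/pℤ`; then `n₁ + |B| + 1 ≤ L`.
[cite: HamidouneRodseth2000, §4 Lemma 6, display (11) (p. 258)] -/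
theorem le_of_apFinset_add_subset_apFinset {B : Finset (ZMod p)} {d a₁ c : ZMod p} (hd : d ≠ 0)
    (hBne : B.Nonempty) (hB2 : #((d +ᵥ B) \ B) = 2) (hBna : ∀ b : ZMod p, ¬ B ⊆ apFinset b d (#B + 1))
    {n₁ L : ℕ} (hn₁ : 1 ≤ n₁) (hsub : apFinset a₁ d n₁ + B ⊆ apFinset c d L) (hCu : apFinset c d L ≠ univ) :
    n₁ + #B + 1 ≤ L := by
  -- translate: `B + {0, …, (n₁-1)d} ⊆ apFinset (c − a₁) d L`
  set S := B + apFinset 0 d n₁ with hS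
  have hS' : apFinset a₁ d n₁ + B = a₁ +ᵥ S := by
    rw [hS, Isoperimetric.apFinset_eq_vadd a₁ d n₁, add_comm B, vadd_add_assoc]
  have hSsub : S ⊆ apFinset (c - a₁) d L := by
    intro x hx
    have : a₁ + x ∈ apFinset c d L := hsub (by rw [hS']; exact mem_vadd_finset.2 ⟨x, hx, rfl⟩)
    obtain ⟨i, hi, hix⟩ := mem_apFinset.1 this
    exact mem_apFinset.2 ⟨i, hi, by rw [sub_add_eq_add_sub, hix, add_sub_cancel_left]⟩
  have hLp : L ≤ p := (lt_of_apFinset_subset_ne_univ hd hCu Subset.rfl).le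
  have hcL : #(apFinset (c - a₁) d L) = L := card_apFinset hd hLp
  have hC₀u : apFinset (c - a₁) d L ≠ univ := by
    intro h; apply hCu
    have := congrArg (fun X => a₁ +ᵥ X) h
    simp only [vadd_apFinset, add_sub_cancel, vadd_finset_univ] at this
    exact this
  have hSu : S ≠ univ := fun h => hC₀u (eq_univ_of_subset hSsub h)
  have hSle : #S ≤ L := hcL ▸ card_le_card hSsub
  rcases (show n₁ = 1 ∨ n₁ = 2 ∨ 3 ≤ n₁ by omega) with h1 | h2 | h3
  · -- `n₁ = 1`: `B ⊆ C₀`, and `L ≤ |B| + 1` would make `B` an almost progression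
    subst h1
    rw [apFinset_one, Finset.singleton_zero, add_zero] at hS
    by_contra hlt
    apply hBna (c - a₁)
    rw [hS] at hSsub
    exact hSsub.trans (Isoperimetric.apFinset_mono _ d (by omega))
  · -- `n₁ = 2`: `S = B + {0,d}` has `|B| + 2` elements and two components, so `S ≠ C₀`
    subst h2
    rw [apFinset_two, zero_add] at hS
    have hcS : #S = #B + 2 := by rw [hS, Isoperimetric.card_add_pair_zero_eq, hB2]
    by_contra hlt
    have hSeq : S = apFinset (c - a₁) d L := eq_of_subset_of_card_le hSsub (by omega)
    have hrun : #((d +ᵥ S) \ S) ≤ 1 := by rw [hSeq]; exact Isoperimetric.card_vadd_sdiff_apFinset_le_one _ d L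
    have hY : S = B ∪ (d +ᵥ B) := by rw [hS]; exact add_pair_zero_eq_union B d
    rw [hY] at hrun hSu
    obtain ⟨s, hs⟩ := subset_apFinset_of_runs_le_two_of_runs_union_le_one hd hBne (by omega) hSu hrun
    exact hBna s hs
  · -- `n₁ ≥ 3`: the chain count
    have hmono := card_add_apFinset_zero_mono hd hBne (n₁ - 1) (by omega)
      (by rw [show n₁ - 1 + 1 = n₁ by omega]; exact hSu)
    rw [show n₁ - 1 + 1 = n₁ by omega, ← hS] at hmono
    have h3u : B + apFinset 0 d 3 ≠ univ := fun h =>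
      hSu (eq_univ_of_subset (add_subset_add_left (Isoperimetric.apFinset_mono 0 d h3)) h)
    have hthree := card_add_apFinset_zero_three_ge hd hBne hB2 hBna h3u
    omega

/-! ## Lemma 6 -/

/-- **Lemma 6 of Hamidoune–Rødseth, first part** (p. 257): "Let `|A|, |B| ≥ 3`, and suppose that
`|A + B| = |A| + |B| ≤ p − 4`.  Also assume that both `A` and `B` are double 1-progressions, and that `B` is
not an almost 1-progression.  Let `A₁` be a 1-component of `A`, and let `B₁, B₂` be the two 1-components of
`B`.  Then `A₁ + B₁` and `A₁ + B₂` lie in distinct 1-components of `A + B`."  Formalised as: NO component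
`C = apFinset c d L` of `A + B` contains `A₁ + B`.  Proof as printed: `|C| ≥ |A₁| + |B| + 1` by (11);
`C = A + B` would make `A + B` a progression and `B` an almost progression (Lemma 3); otherwise a second
component `C′` contains `A₂ + Bᵢ` for some `i`, and `p − 4 ≥ |A| + |B| ≥ |C| + |C′| ≥ |A| + |B| + |Bᵢ|`.
(Only `A = A₁ ∪ A₂` with `|A₁| + |A₂| = |A|` is used about `A`; `|A|, |B| ≥ 3` are not needed.)
[cite: HamidouneRodseth2000, §4 Lemma 6 (pp. 257–258)] -/
theorem not_add_subset_component {A B : Finset (ZMod p)} {d a₁ a₂ b₁ b₂ c : ZMod p} (hd : d ≠ 0)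
    {n₁ n₂ m₁ m₂ L : ℕ} (hA : A = apFinset a₁ d n₁ ∪ apFinset a₂ d n₂) (hn₁ : 1 ≤ n₁) (hn₂ : 1 ≤ n₂)
    (hcardA : n₁ + n₂ = #A) (hB : B = apFinset b₁ d m₁ ∪ apFinset b₂ d m₂) (hm₁ : 1 ≤ m₁) (hm₂ : 1 ≤ m₂)
    (hcardB : m₁ + m₂ = #B) (hB2 : #((d +ᵥ B) \ B) = 2) (hBna : ∀ b : ZMod p, ¬ B ⊆ apFinset b d (#B + 1))
    (hAB : #(A + B) = #A + #B) (hp4 : #(A + B) + 4 ≤ p)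
    (hCX : apFinset c d L ⊆ A + B) (hpre : c - d ∉ A + B) (hpost : c + L • d ∉ A + B)
    (hsub : apFinset a₁ d n₁ + B ⊆ apFinset c d L) : False := by
  have hAne : A.Nonempty := card_pos.1 (by omega)
  have hBne : B.Nonempty := card_pos.1 (by omega)
  have hXu : A + B ≠ univ := ne_univ_of_card_lt (by omega)
  have hCu : apFinset c d L ≠ univ := fun h => hXu (eq_univ_of_subset hCX h)
  have hLp : L < p := lt_of_apFinset_subset_ne_univ hd hXu hCX
  have hcC : #(apFinset c d L) = L := card_apFinset hd hLp.le
  have h11 := le_of_apFinset_add_subset_apFinset hd hBne hB2 hBna hn₁ hsub hCu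
  by_cases hCeq : apFinset c d L = A + B
  · -- `A + B` is a progression: Lemma 3 makes `B` an almost progression
    have hAPd : IsAP (B + A) d := by rw [add_comm, ← hCeq]; exact isAP_apFinset hd hLp.le
    obtain ⟨s, hs⟩ := subset_apFinset_of_isAP_add hd hBne hAne hAPd (by rw [add_comm]; omega) (by omega)
    exact hBna s hs
  · -- a second component
    obtain ⟨x, hxX, hxC⟩ : ∃ x ∈ A + B, x ∉ apFinset c d L := by
      by_contra h; push Not at h
      exact hCeq (Subset.antisymm hCX h)
    -- `x ∈ A₂ + Bᵢ` for some `i`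
    have hxA₂ : x ∈ apFinset a₂ d n₂ + B := by
      rw [hA, union_add, mem_union] at hxX
      exact hxX.resolve_left fun h => hxC (hsub h)
    have key : ∀ (b : ZMod p) (m : ℕ), 1 ≤ m → apFinset b d m ⊆ B →
        x ∈ apFinset a₂ d n₂ + apFinset b d m → False := by
      intro b m hm hbB hxP
      have hPX : apFinset a₂ d n₂ + apFinset b d m ⊆ A + B :=
        add_subset_add (by rw [hA]; exact subset_union_right) hbB
      have hPu : apFinset a₂ d n₂ + apFinset b d m ≠ univ := fun h => hXu (eq_univ_of_subset hPX h)
      obtain ⟨hPeq, hPc⟩ := apFinset_add_apFinset_eq hd hn₂ hm hPu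
      obtain ⟨c', L', hL', hC'X, hpre', hpost', hxC'⟩ := exists_component hd hXu hxX
      have hPC' : apFinset a₂ d n₂ + apFinset b d m ⊆ apFinset c' d L' := by
        rw [hPeq] at hPX hxP ⊢
        exact subset_component_of_inter_nonempty hd hC'X hpre' hpost' hPX ⟨x, mem_inter.2 ⟨hxP, hxC'⟩⟩
      have hne : apFinset c d L ≠ apFinset c' d L' := by
        intro h; rw [h] at hxC; exact hxC hxC'
      have hdisj : Disjoint (apFinset c d L) (apFinset c' d L') := by
        rw [disjoint_iff_inter_eq_empty]
        by_contra h'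
        exact hne (component_eq_of_inter_nonempty hd hCX hpre hpost hC'X hpre' hpost'
          (nonempty_iff_ne_empty.2 h'))
      have hL'p : L' < p := lt_of_apFinset_subset_ne_univ hd hXu hC'X
      have hcard := card_le_card (union_subset hCX hC'X)
      rw [card_union_of_disjoint hdisj, hcC, card_apFinset hd hL'p.le] at hcard
      have := card_le_card hPC'
      rw [hPc, card_apFinset hd hL'p.le] at this
      omega
    rw [hB, add_union, mem_union] at hxA₂
    rcases hxA₂ with h | h
    · exact key b₁ m₁ hm₁ (by rw [hB]; exact subset_union_left) h
    · exact key b₂ m₂ hm₂ (by rw [hB]; exact subset_union_right) h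

/-- **Lemma 6 of Hamidoune–Rødseth, second part** (display (10), p. 257): under the same hypotheses,
`|A₁| ≥ |A|/2 − 1`, i.e. `2 |A₁| ≤ |A| + 2`.  Proof as printed: `A₁ + B₁` and `A₁ + B₂` lie in distinct
components, so `p − 4 ≥ |A + B| ≥ |A₁ + B₁| + |A₁ + B₂| ≥ 2|A₁| + |B| − 2`.
[cite: HamidouneRodseth2000, §4 Lemma 6, display (10) (pp. 257–258)] -/
theorem two_mul_le_card_add_two {A B : Finset (ZMod p)} {d a₁ a₂ b₁ b₂ : ZMod p} (hd : d ≠ 0)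
    {n₁ n₂ m₁ m₂ : ℕ} (hA : A = apFinset a₁ d n₁ ∪ apFinset a₂ d n₂) (hn₁ : 1 ≤ n₁) (hn₂ : 1 ≤ n₂)
    (hcardA : n₁ + n₂ = #A) (hB : B = apFinset b₁ d m₁ ∪ apFinset b₂ d m₂) (hm₁ : 1 ≤ m₁) (hm₂ : 1 ≤ m₂)
    (hcardB : m₁ + m₂ = #B) (hB2 : #((d +ᵥ B) \ B) = 2) (hBna : ∀ b : ZMod p, ¬ B ⊆ apFinset b d (#B + 1))
    (hAB : #(A + B) = #A + #B) (hp4 : #(A + B) + 4 ≤ p) : 2 * n₁ ≤ #A + 2 := by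
  have hXu : A + B ≠ univ := ne_univ_of_card_lt (by omega)
  have hA₁A : apFinset a₁ d n₁ ⊆ A := by rw [hA]; exact subset_union_left
  -- the two runs `A₁ + B₁`, `A₁ + B₂` and their components
  have piece : ∀ (b : ZMod p) (m : ℕ), 1 ≤ m → apFinset b d m ⊆ B →
      ∃ c : ZMod p, ∃ L : ℕ, apFinset c d L ⊆ A + B ∧ c - d ∉ A + B ∧ c + L • d ∉ A + B ∧
        apFinset a₁ d n₁ + apFinset b d m ⊆ apFinset c d L ∧ n₁ + m - 1 ≤ #(apFinset c d L) := by
    intro b m hm hbB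
    have hPX : apFinset a₁ d n₁ + apFinset b d m ⊆ A + B := add_subset_add hA₁A hbB
    have hPu : apFinset a₁ d n₁ + apFinset b d m ≠ univ := fun h => hXu (eq_univ_of_subset hPX h)
    obtain ⟨hPeq, hPc⟩ := apFinset_add_apFinset_eq hd hn₁ hm hPu
    have hx : a₁ + b ∈ apFinset a₁ d n₁ + apFinset b d m :=
      add_mem_add (mem_apFinset.2 ⟨0, by omega, by simp⟩) (mem_apFinset.2 ⟨0, by omega, by simp⟩)
    obtain ⟨c, L, -, hCX, hpre, hpost, hxC⟩ := exists_component hd hXu (hPX hx)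
    have hPC : apFinset a₁ d n₁ + apFinset b d m ⊆ apFinset c d L := by
      rw [hPeq] at hPX hx ⊢
      exact subset_component_of_inter_nonempty hd hCX hpre hpost hPX ⟨_, mem_inter.2 ⟨hx, hxC⟩⟩
    refine ⟨c, L, hCX, hpre, hpost, hPC, ?_⟩
    have := card_le_card hPC
    rwa [hPc] at this
  obtain ⟨c, L, hCX, hpre, hpost, hPC, hcL⟩ := piece b₁ m₁ hm₁ (by rw [hB]; exact subset_union_left)
  obtain ⟨c', L', hC'X, hpre', hpost', hPC', hcL'⟩ := piece b₂ m₂ hm₂ (by rw [hB]; exact subset_union_right)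
  -- they are distinct components
  have hne : apFinset c d L ≠ apFinset c' d L' := by
    intro h
    rw [h] at hPC
    apply not_add_subset_component hd hA hn₁ hn₂ hcardA hB hm₁ hm₂ hcardB hB2 hBna hAB hp4 hC'X hpre' hpost'
    rw [hB, add_union]
    exact union_subset hPC hPC'
  have hdisj : Disjoint (apFinset c d L) (apFinset c' d L') := by
    rw [disjoint_iff_inter_eq_empty]
    by_contra h'
    exact hne (component_eq_of_inter_nonempty hd hCX hpre hpost hC'X hpre' hpost'
      (nonempty_iff_ne_empty.2 h'))
  have hcard := card_le_card (union_subset hCX hC'X)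
  rw [card_union_of_disjoint hdisj] at hcard
  omega

/-! ## Lemma 7 -/

/-- The component of `A + B` through the run `Aⱼ + Bₖ` (a run inside `A + B ≠ ℤ/pℤ` lies in a component,
which then has at least `|Aⱼ| + |Bₖ| − 1` elements).
[cite: HamidouneRodseth2000, §2 (p. 253: `d`-components) and §4 Lemma 6 (p. 258)] -/
theorem exists_component_superset_add {A B : Finset (ZMod p)} {d a b : ZMod p} (hd : d ≠ 0) {n m : ℕ}
    (hXu : A + B ≠ univ) (hPA : apFinset a d n ⊆ A) (hQB : apFinset b d m ⊆ B) (hn : 1 ≤ n) (hm : 1 ≤ m) :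
    ∃ c : ZMod p, ∃ L : ℕ, 1 ≤ L ∧ apFinset c d L ⊆ A + B ∧ c - d ∉ A + B ∧ c + L • d ∉ A + B ∧
      apFinset a d n + apFinset b d m ⊆ apFinset c d L ∧ n + m - 1 ≤ #(apFinset c d L) ∧
      apFinset a d n + apFinset b d m = apFinset (a + b) d (n + m - 1) ∧
      #(apFinset a d n + apFinset b d m) = n + m - 1 := by
  have hPX : apFinset a d n + apFinset b d m ⊆ A + B := add_subset_add hPA hQB
  have hPu : apFinset a d n + apFinset b d m ≠ univ := fun h => hXu (eq_univ_of_subset hPX h)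
  obtain ⟨hPeq, hPc⟩ := apFinset_add_apFinset_eq hd hn hm hPu
  have hx : a + b ∈ apFinset a d n + apFinset b d m :=
    add_mem_add (mem_apFinset.2 ⟨0, by omega, by simp⟩) (mem_apFinset.2 ⟨0, by omega, by simp⟩)
  obtain ⟨c, L, hL, hCX, hpre, hpost, hxC⟩ := exists_component hd hXu (hPX hx)
  have hPC : apFinset a d n + apFinset b d m ⊆ apFinset c d L := by
    rw [hPeq] at hPX hx ⊢
    exact subset_component_of_inter_nonempty hd hCX hpre hpost hPX ⟨_, mem_inter.2 ⟨hx, hxC⟩⟩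
  refine ⟨c, L, hL, hCX, hpre, hpost, hPC, ?_, hPeq, hPc⟩
  have := card_le_card hPC
  rwa [hPc] at this

/-- Two distinct components of `X` are disjoint. [cite: HamidouneRodseth2000, §2 (p. 253: "a unique partition
into `d`-components")] -/
theorem disjoint_components_of_ne {X : Finset (ZMod p)} {c c' d : ZMod p} (hd : d ≠ 0) {L L' : ℕ}
    (hCX : apFinset c d L ⊆ X) (hpre : c - d ∉ X) (hpost : c + L • d ∉ X)
    (hC'X : apFinset c' d L' ⊆ X) (hpre' : c' - d ∉ X) (hpost' : c' + L' • d ∉ X)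
    (hne : apFinset c d L ≠ apFinset c' d L') : Disjoint (apFinset c d L) (apFinset c' d L') := by
  rw [disjoint_iff_inter_eq_empty]
  by_contra h'
  exact hne (component_eq_of_inter_nonempty hd hCX hpre hpost hC'X hpre' hpost' (nonempty_iff_ne_empty.2 h'))

/-- **The count in the proof of Lemma 7** (pp. 258–259): with the data of Lemma 6, if `A + B` has at least
three `d`-components then a third component contains `A₂ + Bᵢ` for `i = 1` or `2`, and
`p − 4 ≥ |A| + |B| ≥ |A₁ + B₁| + |A₁ + B₂| + |A₂ + Bᵢ| ≥ |A| + |B| + |A₁| + |Bᵢ| − 3`, so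
`|A₁| + |Bᵢ| ≤ 3` (display (12)).
[cite: HamidouneRodseth2000, §4 Lemma 7, display (12) (pp. 258–259)] -/
theorem exists_small_of_three_le_runs {A B : Finset (ZMod p)} {d a₁ a₂ b₁ b₂ : ZMod p} (hd : d ≠ 0)
    {n₁ n₂ m₁ m₂ : ℕ} (hA : A = apFinset a₁ d n₁ ∪ apFinset a₂ d n₂) (hn₁ : 1 ≤ n₁) (hn₂ : 1 ≤ n₂)
    (hcardA : n₁ + n₂ = #A) (hB : B = apFinset b₁ d m₁ ∪ apFinset b₂ d m₂) (hm₁ : 1 ≤ m₁) (hm₂ : 1 ≤ m₂)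
    (hcardB : m₁ + m₂ = #B) (hB2 : #((d +ᵥ B) \ B) = 2) (hBna : ∀ b : ZMod p, ¬ B ⊆ apFinset b d (#B + 1))
    (hAB : #(A + B) = #A + #B) (hp4 : #(A + B) + 4 ≤ p) (h3 : 3 ≤ #((d +ᵥ (A + B)) \ (A + B))) :
    n₁ + m₁ ≤ 3 ∨ n₁ + m₂ ≤ 3 := by
  have hXu : A + B ≠ univ := ne_univ_of_card_lt (by omega)
  have hA₁A : apFinset a₁ d n₁ ⊆ A := by rw [hA]; exact subset_union_left
  have hA₂A : apFinset a₂ d n₂ ⊆ A := by rw [hA]; exact subset_union_right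
  have hB₁B : apFinset b₁ d m₁ ⊆ B := by rw [hB]; exact subset_union_left
  have hB₂B : apFinset b₂ d m₂ ⊆ B := by rw [hB]; exact subset_union_right
  obtain ⟨c, L, hL, hCX, hpre, hpost, hPC, hcL, -, -⟩ := exists_component_superset_add hd hXu hA₁A hB₁B hn₁ hm₁
  obtain ⟨c', L', hL', hC'X, hpre', hpost', hPC', hcL', -, -⟩ :=
    exists_component_superset_add hd hXu hA₁A hB₂B hn₁ hm₂
  have hne : apFinset c d L ≠ apFinset c' d L' := by
    intro h
    rw [h] at hPC
    apply not_add_subset_component hd hA hn₁ hn₂ hcardA hB hm₁ hm₂ hcardB hB2 hBna hAB hp4 hC'X hpre' hpost'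
    rw [hB, add_union]; exact union_subset hPC hPC'
  have hd12 := disjoint_components_of_ne hd hCX hpre hpost hC'X hpre' hpost' hne
  -- a point outside both components
  obtain ⟨x, hxX, hxCC⟩ : ∃ x ∈ A + B, x ∉ apFinset c d L ∪ apFinset c' d L' := by
    by_contra h; push Not at h
    have hXeq : A + B = apFinset c d L ∪ apFinset c' d L' := Subset.antisymm h (union_subset hCX hC'X)
    have := card_vadd_sdiff_union_le d (apFinset c d L) (apFinset c' d L')
    rw [← hXeq] at this
    have h1 := Isoperimetric.card_vadd_sdiff_apFinset_le_one c d L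
    have h2 := Isoperimetric.card_vadd_sdiff_apFinset_le_one c' d L'
    omega
  rw [mem_union, not_or] at hxCC
  have hxA₂ : x ∈ apFinset a₂ d n₂ + B := by
    have : x ∈ (apFinset a₁ d n₁ + B) ∪ (apFinset a₂ d n₂ + B) := by rw [← union_add, ← hA]; exact hxX
    rw [mem_union] at this
    refine this.resolve_left fun h => ?_
    rw [hB, add_union, mem_union] at h
    rcases h with h | h
    · exact hxCC.1 (hPC h)
    · exact hxCC.2 (hPC' h)
  have key : ∀ (b : ZMod p) (m : ℕ), 1 ≤ m → apFinset b d m ⊆ B →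
      x ∈ apFinset a₂ d n₂ + apFinset b d m → n₁ + m ≤ 3 := by
    intro b m hm hbB hxP
    obtain ⟨c'', L'', hL'', hC''X, hpre'', hpost'', -, -, hPeq, hPc⟩ :=
      exists_component_superset_add hd hXu hA₂A hbB hn₂ hm
    -- the component through `x` (not necessarily the one just produced): take it directly
    obtain ⟨e, M, hM, hEX, hpreE, hpostE, hxE⟩ := exists_component hd hXu hxX
    have hPX : apFinset a₂ d n₂ + apFinset b d m ⊆ A + B := add_subset_add hA₂A hbB
    have hPE : apFinset a₂ d n₂ + apFinset b d m ⊆ apFinset e d M := by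
      rw [hPeq] at hPX hxP ⊢
      exact subset_component_of_inter_nonempty hd hEX hpreE hpostE hPX ⟨x, mem_inter.2 ⟨hxP, hxE⟩⟩
    have hne1 : apFinset c d L ≠ apFinset e d M := by intro h; rw [h] at hxCC; exact hxCC.1 hxE
    have hne2 : apFinset c' d L' ≠ apFinset e d M := by intro h; rw [h] at hxCC; exact hxCC.2 hxE
    have hd13 := disjoint_components_of_ne hd hCX hpre hpost hEX hpreE hpostE hne1
    have hd23 := disjoint_components_of_ne hd hC'X hpre' hpost' hEX hpreE hpostE hne2
    have hcard := card_le_card (union_subset (union_subset hCX hC'X) hEX)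
    rw [card_union_of_disjoint (disjoint_union_left.2 ⟨hd13, hd23⟩), card_union_of_disjoint hd12] at hcard
    have := card_le_card hPE
    rw [hPc] at this
    omega
  rw [hB, add_union, mem_union] at hxA₂
  rcases hxA₂ with h | h
  · exact Or.inl (key b₁ m₁ hm₁ hB₁B h)
  · exact Or.inr (key b₂ m₂ hm₂ hB₂B h)

/-- A run inside a set with two components lies inside one of them. [cite: HamidouneRodseth2000, §2 (p. 253:
`d`-components)] -/
theorem subset_or_subset_of_subset_union {X : Finset (ZMod p)} {x c₁ c₂ d : ZMod p} (hd : d ≠ 0)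
    {k L₁ L₂ : ℕ} (hk : 1 ≤ k) (hX : X = apFinset c₁ d L₁ ∪ apFinset c₂ d L₂)
    (hD₁X : apFinset c₁ d L₁ ⊆ X) (hpre₁ : c₁ - d ∉ X) (hpost₁ : c₁ + L₁ • d ∉ X)
    (hD₂X : apFinset c₂ d L₂ ⊆ X) (hpre₂ : c₂ - d ∉ X) (hpost₂ : c₂ + L₂ • d ∉ X)
    (hP : apFinset x d k ⊆ X) : apFinset x d k ⊆ apFinset c₁ d L₁ ∨ apFinset x d k ⊆ apFinset c₂ d L₂ := by
  have hx : x ∈ apFinset x d k := mem_apFinset.2 ⟨0, by omega, by simp⟩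
  have hxX := hP hx
  rw [hX, mem_union] at hxX
  rcases hxX with h | h
  · exact Or.inl (subset_component_of_inter_nonempty hd hD₁X hpre₁ hpost₁ hP ⟨x, mem_inter.2 ⟨hx, h⟩⟩)
  · exact Or.inr (subset_component_of_inter_nonempty hd hD₂X hpre₂ hpost₂ hP ⟨x, mem_inter.2 ⟨hx, h⟩⟩)

/-- **Lemma 7, last paragraph** (p. 259): once `A + B` is known to have exactly two components `C₁, C₂`
with `A₁ + B₁ ⊆ C₁`, Lemma 6 (applied to `A₁`, to `B₁` and to `B₂`) forces `A₁ + B₂ ⊆ C₂`,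
`A₂ + B₁ ⊆ C₂`, `A₂ + B₂ ⊆ C₁`, hence `C₁ = (A₁ + B₁) ∪ (A₂ + B₂)` and `C₂ = (A₂ + B₁) ∪ (A₁ + B₂)`.
[cite: HamidouneRodseth2000, §4 Lemma 7 (p. 259)] -/
theorem components_eq_of_subset {A B : Finset (ZMod p)} {d a₁ a₂ b₁ b₂ c₁ c₂ : ZMod p} (hd : d ≠ 0)
    {n₁ n₂ m₁ m₂ L₁ L₂ : ℕ} (hA : A = apFinset a₁ d n₁ ∪ apFinset a₂ d n₂) (hn₁ : 1 ≤ n₁) (hn₂ : 1 ≤ n₂)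
    (hcardA : n₁ + n₂ = #A) (hA2 : #((d +ᵥ A) \ A) = 2) (hAna : ∀ a : ZMod p, ¬ A ⊆ apFinset a d (#A + 1))
    (hB : B = apFinset b₁ d m₁ ∪ apFinset b₂ d m₂) (hm₁ : 1 ≤ m₁) (hm₂ : 1 ≤ m₂)
    (hcardB : m₁ + m₂ = #B) (hB2 : #((d +ᵥ B) \ B) = 2) (hBna : ∀ b : ZMod p, ¬ B ⊆ apFinset b d (#B + 1))
    (hAB : #(A + B) = #A + #B) (hp4 : #(A + B) + 4 ≤ p)
    (hX : A + B = apFinset c₁ d L₁ ∪ apFinset c₂ d L₂)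
    (hdisj : Disjoint (apFinset c₁ d L₁) (apFinset c₂ d L₂))
    (hD₁X : apFinset c₁ d L₁ ⊆ A + B) (hpre₁ : c₁ - d ∉ A + B) (hpost₁ : c₁ + L₁ • d ∉ A + B)
    (hD₂X : apFinset c₂ d L₂ ⊆ A + B) (hpre₂ : c₂ - d ∉ A + B) (hpost₂ : c₂ + L₂ • d ∉ A + B)
    (h11 : apFinset a₁ d n₁ + apFinset b₁ d m₁ ⊆ apFinset c₁ d L₁) :
    apFinset c₁ d L₁ = (apFinset a₁ d n₁ + apFinset b₁ d m₁) ∪ (apFinset a₂ d n₂ + apFinset b₂ d m₂) ∧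
      apFinset c₂ d L₂ = (apFinset a₂ d n₂ + apFinset b₁ d m₁) ∪ (apFinset a₁ d n₁ + apFinset b₂ d m₂) := by
  have hXu : A + B ≠ univ := ne_univ_of_card_lt (by omega)
  have hA₁A : apFinset a₁ d n₁ ⊆ A := by rw [hA]; exact subset_union_left
  have hA₂A : apFinset a₂ d n₂ ⊆ A := by rw [hA]; exact subset_union_right
  have hB₁B : apFinset b₁ d m₁ ⊆ B := by rw [hB]; exact subset_union_left
  have hB₂B : apFinset b₂ d m₂ ⊆ B := by rw [hB]; exact subset_union_right
  -- the symmetric data (`B + A = A + B`)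
  have hBA : B + A = A + B := add_comm B A
  have hAB' : #(B + A) = #B + #A := by rw [hBA, hAB, add_comm]
  have hp4' : #(B + A) + 4 ≤ p := by rw [hBA]; exact hp4
  -- each piece is a run inside `A + B`, hence inside `C₁` or `C₂`
  have side : ∀ (a b : ZMod p) (n m : ℕ), 1 ≤ n → 1 ≤ m → apFinset a d n ⊆ A → apFinset b d m ⊆ B →
      apFinset a d n + apFinset b d m ⊆ apFinset c₁ d L₁ ∨ apFinset a d n + apFinset b d m ⊆ apFinset c₂ d L₂ := by
    intro a b n m hn hm haA hbB
    have hPX : apFinset a d n + apFinset b d m ⊆ A + B := add_subset_add haA hbB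
    have hPu : apFinset a d n + apFinset b d m ≠ univ := fun h => hXu (eq_univ_of_subset hPX h)
    obtain ⟨hPeq, -⟩ := apFinset_add_apFinset_eq hd hn hm hPu
    rw [hPeq] at hPX ⊢
    exact subset_or_subset_of_subset_union hd (by omega) hX hD₁X hpre₁ hpost₁ hD₂X hpre₂ hpost₂ hPX
  -- `A₁ + B₂ ⊆ C₂`
  have h12 : apFinset a₁ d n₁ + apFinset b₂ d m₂ ⊆ apFinset c₂ d L₂ := by
    refine (side a₁ b₂ n₁ m₂ hn₁ hm₂ hA₁A hB₂B).resolve_left fun h => ?_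
    apply not_add_subset_component hd hA hn₁ hn₂ hcardA hB hm₁ hm₂ hcardB hB2 hBna hAB hp4 hD₁X hpre₁ hpost₁
    rw [hB, add_union]; exact union_subset h11 h
  -- `A₂ + B₁ ⊆ C₂` (Lemma 6 for `(B, A)` with the component `B₁`)
  have h21 : apFinset a₂ d n₂ + apFinset b₁ d m₁ ⊆ apFinset c₂ d L₂ := by
    refine (side a₂ b₁ n₂ m₁ hn₂ hm₁ hA₂A hB₁B).resolve_left fun h => ?_
    apply not_add_subset_component hd hB hm₁ hm₂ hcardB hA hn₁ hn₂ hcardA hA2 hAna hAB' hp4'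
      (hBA ▸ hD₁X) (hBA ▸ hpre₁) (hBA ▸ hpost₁)
    rw [hA, add_union, add_comm (apFinset b₁ d m₁), add_comm (apFinset b₁ d m₁)]
    exact union_subset h11 h
  -- `A₂ + B₂ ⊆ C₁` (Lemma 6 for `(B, A)` with the component `B₂`)
  have h22 : apFinset a₂ d n₂ + apFinset b₂ d m₂ ⊆ apFinset c₁ d L₁ := by
    refine (side a₂ b₂ n₂ m₂ hn₂ hm₂ hA₂A hB₂B).resolve_right fun h => ?_
    apply not_add_subset_component hd (hB.trans (union_comm _ _)) hm₂ hm₁ (by omega) hA hn₁ hn₂ hcardA hA2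
      hAna hAB' hp4' (hBA ▸ hD₂X) (hBA ▸ hpre₂) (hBA ▸ hpost₂)
    rw [hA, add_union, add_comm (apFinset b₂ d m₂), add_comm (apFinset b₂ d m₂)]
    exact union_subset h12 h
  -- the four pieces cover `A + B`
  have hcover : A + B = (apFinset a₁ d n₁ + apFinset b₁ d m₁ ∪ (apFinset a₂ d n₂ + apFinset b₂ d m₂)) ∪
      (apFinset a₂ d n₂ + apFinset b₁ d m₁ ∪ (apFinset a₁ d n₁ + apFinset b₂ d m₂)) := by
    rw [hA, hB, union_add, add_union, add_union]
    ext x; simp only [mem_union]; tauto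
  have hdisj' := hdisj
  rw [disjoint_left] at hdisj'
  constructor
  · refine Subset.antisymm (fun x hx => ?_) (union_subset h11 h22)
    have hxX := hD₁X hx
    rw [hcover, mem_union] at hxX
    exact hxX.resolve_right fun h => hdisj' hx (union_subset h21 h12 h)
  · refine Subset.antisymm (fun x hx => ?_) (union_subset h21 h12)
    have hxX := hD₂X hx
    rw [hcover, mem_union] at hxX
    exact hxX.resolve_left fun h => hdisj' (union_subset h11 h22 h) hx

/-- **Lemma 7 of Hamidoune–Rødseth** (p. 258): "Let `|A|, |B| ≥ 3`, and suppose that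
`7 ≤ |A + B| = |A| + |B| ≤ p − 4`.  Let `A₁, A₂` be the distinct 1-components of `A`, and let `B₁, B₂` be
the distinct 1-components of `B`.  Also suppose that `B` is not an almost `d`-progression for any `d`.  The
1-components of `A + B` are then `(A₁ + B₁) ∪ (A₂ + B₂)` and `(A₂ + B₁) ∪ (A₁ + B₂)`."  Here for a general
step `d ≠ 0`, with both `A` and `B` assumed not almost `d`-progressions (the paper gets the statement for `A`
from Lemma 5): `A + B` is the disjoint union of two components `C₁ = (A₁ + B₁) ∪ (A₂ + B₂)` and
`C₂ = (A₂ + B₁) ∪ (A₁ + B₂)`, `|C₁| + |C₂| = |A + B|`.  Proof as printed: three components are excluded by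
the count `exists_small_of_three_le_runs` applied to each of `A₁, A₂, B₁, B₂` (giving `|A| + |B| ≤ 6`), two
exist by Lemma 6, and the pairing is `components_eq_of_subset`.
[cite: HamidouneRodseth2000, §4 Lemma 7 (pp. 258–259)] -/
theorem components_of_double_double {A B : Finset (ZMod p)} {d a₁ a₂ b₁ b₂ : ZMod p} (hd : d ≠ 0)
    {n₁ n₂ m₁ m₂ : ℕ} (hA : A = apFinset a₁ d n₁ ∪ apFinset a₂ d n₂) (hn₁ : 1 ≤ n₁) (hn₂ : 1 ≤ n₂)
    (hcardA : n₁ + n₂ = #A) (hA2 : #((d +ᵥ A) \ A) = 2) (hAna : ∀ a : ZMod p, ¬ A ⊆ apFinset a d (#A + 1))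
    (hB : B = apFinset b₁ d m₁ ∪ apFinset b₂ d m₂) (hm₁ : 1 ≤ m₁) (hm₂ : 1 ≤ m₂)
    (hcardB : m₁ + m₂ = #B) (hB2 : #((d +ᵥ B) \ B) = 2) (hBna : ∀ b : ZMod p, ¬ B ⊆ apFinset b d (#B + 1))
    (h7 : 7 ≤ #(A + B)) (hAB : #(A + B) = #A + #B) (hp4 : #(A + B) + 4 ≤ p) :
    ∃ c₁ c₂ : ZMod p, ∃ L₁ L₂ : ℕ, 1 ≤ L₁ ∧ 1 ≤ L₂ ∧ L₁ + L₂ = #(A + B) ∧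
      A + B = apFinset c₁ d L₁ ∪ apFinset c₂ d L₂ ∧ Disjoint (apFinset c₁ d L₁) (apFinset c₂ d L₂) ∧
      apFinset c₁ d L₁ = (apFinset a₁ d n₁ + apFinset b₁ d m₁) ∪ (apFinset a₂ d n₂ + apFinset b₂ d m₂) ∧
      apFinset c₂ d L₂ = (apFinset a₂ d n₂ + apFinset b₁ d m₁) ∪ (apFinset a₁ d n₁ + apFinset b₂ d m₂) := by
  have hXu : A + B ≠ univ := ne_univ_of_card_lt (by omega)
  have hBA : B + A = A + B := add_comm B A
  have hAB' : #(B + A) = #B + #A := by rw [hBA, hAB, add_comm]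
  have hp4' : #(B + A) + 4 ≤ p := by rw [hBA]; exact hp4
  -- at most two components
  have hle2 : #((d +ᵥ (A + B)) \ (A + B)) ≤ 2 := by
    by_contra h3; push Not at h3
    have h3' : 3 ≤ #((d +ᵥ (B + A)) \ (B + A)) := by rw [hBA]; omega
    have r1 := exists_small_of_three_le_runs hd hA hn₁ hn₂ hcardA hB hm₁ hm₂ hcardB hB2 hBna hAB hp4 (by omega)
    have r2 := exists_small_of_three_le_runs hd (hA.trans (union_comm _ _)) hn₂ hn₁ (by omega) hB hm₁ hm₂
      hcardB hB2 hBna hAB hp4 (by omega)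
    have r3 := exists_small_of_three_le_runs hd hB hm₁ hm₂ hcardB hA hn₁ hn₂ hcardA hA2 hAna hAB' hp4' h3'
    have r4 := exists_small_of_three_le_runs hd (hB.trans (union_comm _ _)) hm₂ hm₁ (by omega) hA hn₁ hn₂
      hcardA hA2 hAna hAB' hp4' h3'
    omega
  -- at least two components (Lemma 6)
  have hA₁A : apFinset a₁ d n₁ ⊆ A := by rw [hA]; exact subset_union_left
  have hB₁B : apFinset b₁ d m₁ ⊆ B := by rw [hB]; exact subset_union_left
  have hB₂B : apFinset b₂ d m₂ ⊆ B := by rw [hB]; exact subset_union_right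
  obtain ⟨c, L, hL, hCX, hpre, hpost, hPC, -, -, -⟩ := exists_component_superset_add hd hXu hA₁A hB₁B hn₁ hm₁
  obtain ⟨c', L', hL', hC'X, hpre', hpost', hPC', -, -, -⟩ :=
    exists_component_superset_add hd hXu hA₁A hB₂B hn₁ hm₂
  have hne : apFinset c d L ≠ apFinset c' d L' := by
    intro h
    rw [h] at hPC
    apply not_add_subset_component hd hA hn₁ hn₂ hcardA hB hm₁ hm₂ hcardB hB2 hBna hAB hp4 hC'X hpre' hpost'
    rw [hB, add_union]; exact union_subset hPC hPC'
  have hge2 := two_le_card_vadd_sdiff hd hL hL' hCX hpre hpost hC'X hpre' hpost' hne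
  have h2 : #((d +ᵥ (A + B)) \ (A + B)) = 2 := by omega
  obtain ⟨c₁, c₂, L₁, L₂, hL₁, hL₂, hLsum, hXeq, hDdisj, hD₁X, hpre₁, hpost₁, hD₂X, hpre₂, hpost₂⟩ :=
    exists_two_components hd h2
  -- `A₁ + B₁` lies in one of them; order the two components accordingly
  have hPX : apFinset a₁ d n₁ + apFinset b₁ d m₁ ⊆ A + B := add_subset_add hA₁A hB₁B
  have hPu : apFinset a₁ d n₁ + apFinset b₁ d m₁ ≠ univ := fun h => hXu (eq_univ_of_subset hPX h)
  obtain ⟨hPeq, -⟩ := apFinset_add_apFinset_eq hd hn₁ hm₁ hPu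
  rcases subset_or_subset_of_subset_union hd (k := n₁ + m₁ - 1) (by omega) hXeq hD₁X hpre₁ hpost₁ hD₂X hpre₂
    hpost₂ (hPeq ▸ hPX) with h11 | h11
  · rw [← hPeq] at h11
    obtain ⟨e1, e2⟩ := components_eq_of_subset hd hA hn₁ hn₂ hcardA hA2 hAna hB hm₁ hm₂ hcardB hB2 hBna hAB hp4
      hXeq hDdisj hD₁X hpre₁ hpost₁ hD₂X hpre₂ hpost₂ h11
    exact ⟨c₁, c₂, L₁, L₂, hL₁, hL₂, hLsum, hXeq, hDdisj, e1, e2⟩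
  · rw [← hPeq] at h11
    obtain ⟨e1, e2⟩ := components_eq_of_subset hd hA hn₁ hn₂ hcardA hA2 hAna hB hm₁ hm₂ hcardB hB2 hBna hAB hp4
      (hXeq.trans (union_comm _ _)) hDdisj.symm hD₂X hpre₂ hpost₂ hD₁X hpre₁ hpost₁ h11
    exact ⟨c₂, c₁, L₂, L₁, hL₂, hL₁, by omega, hXeq.trans (union_comm _ _), hDdisj.symm, e1, e2⟩

end HamidouneRodseth

end Literature.Combinatorics.Additive
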